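import Summits.ResolutionOfSingularities.ResolutionOfSingularities.Theses.MaxContactCut
import Summits.ResolutionOfSingularities.ResolutionOfSingularities.Theorems.FrobeniusBracketPow
import Summits.ResolutionOfSingularities.ResolutionOfSingularities.Theorems.MaxContactCutTauCut
import HarnessLib

/-!
# MaxContactCutFedderCut — kernels of the decomp-res node N44 «FedderCut» (lens-6 g8, critic row 51), phase 3

By-name kernels linking the seven FedderCut asides of route MaxContactCut (rev 11: `StepPICoreImpureDimFour` 30699,
`StepPICorePureDimFour` 30700, `StepPICorePureTameDimFour` 30701, `StepPICorePureLowDimFour` 30702,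
`StepPICorePureHighDimFour` 30703, `StepPICoreImpure` 30704, `StepPICorePure` 30705) to their parents
`StepPICoreDimFour` (28544, the located dim-4 wild core, declared residual) and `StepPICore` (28538), to lens-5's
ExponentLadder asides `StepPICoreShallowDimFour` / `StepPICoreDeepDimFour` (29781 / 29782) and to the ROOT.
Lens file HOME/decomp-res-lens-6/g8/FedderCut.lean sha256 24f14f731384df7d… (478 lines, rc 0 · 0 sorry); census
instrument fedder/T-fedder-bed-0.json 6b642a67… (56/59 wild dim ≥ 4 bed germs Fedder-impure at the vertex).

* EXACTNESS (excluded middle on «every located point is Fedder-pure», nothing else):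
  `28544 ⟺ IMPURE₄ ∧ PURE₄`, `PURE₄ ⟺ PURE-TAME₄ ∧ PURE-LOW₄ ∧ PURE-HIGH₄` (trisection
  `n < p ∣ p ≤ n ≤ 3 ∣ p ≤ n ∧ 4 ≤ n`), `28538 ⟺ IMPURE ∧ PURE`.
* THE DECIDED LEAF: `stepPICorePureHighDimFour_holds : MaxContactCut.StepPICorePureHighDimFour` — PROVED OUTRIGHT
  from the certificate `FrobeniusBracketPow.fedderImpure_of_hyperplanar_of_regular` (a hyperplanar point of order
  `n ≥ max(p, 4)` on a regular `Y` of dimension `≤ 4` is Fedder-impure), so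
  `28544 ⟺ IMPURE₄ ∧ PURE-TAME₄ ∧ PURE-LOW₄`.
* CROSS-LENS SQUARE with ExponentLadder: `DEEP₄ ⊆ IMPURE₄` (`deep_of_impure`),
  `PURE-TAME₄, PURE-LOW₄ ⊆ SHALLOW₄`, hence `SHALLOW₄ ∧ IMPURE₄ ⟹ 28544`; perfect-column vacuity of PURE-TAME₄'s
  datum modulo the port `TameHasContact` 28012.
* `closes`: the MaxContactCut pocket pieces + `IMPURE` + `PURE` ⟹ `_root_.ResolutionOfSingularities` through
  `MaxContactCutTauCut.closes_tauCut` BY NAME; necessity of every piece from the ROOT (`*_of_summit`).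

WHY THIS IS NOVEL (critic row 51): no other node of the cell reads the F-SINGULARITY CLASS of the located base point;
the carving comes with a proved emptiness certificate from order 4 on («the F-pure part of the wild core has order
≤ 3»). Pure logic over the typed clauses + the phase-1 certificate; 0 sorry.
-/

namespace Summit.ResolutionOfSingularities.ResolutionOfSingularities.Theorems.MaxContactCutFedderCut

open CategoryTheory AlgebraicGeometry
open Summit.ResolutionOfSingularities.ResolutionOfSingularities.Theses
open Summit.ResolutionOfSingularities.ResolutionOfSingularities.Theorems

/-! ## Dimension 4: excluded middle on the purity clause -/

/-- Necessity of IMPURE₄ (30699) from the core 28544. [folklore] -/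
theorem impureDimFour_of_core (h : MaxContactCut.StepPICoreDimFour) : MaxContactCut.StepPICoreImpureDimFour := by
  intro p hp k _ _ n hn ih Y g hgs hgf hgq hY hdim Γ b hbs hbf hbq hbir hred hdat
  obtain ⟨I, hbl, hord, ⟨y, hyn, hcf, hhyp, _⟩, hloc⟩ := hdat
  exact h p hp k n hn ih Y g hgs hgf hgq hY hdim Γ b hbs hbf hbq hbir hred ⟨I, hbl, hord, ⟨y, hyn, hcf, hhyp⟩, hloc⟩

/-- Necessity of PURE₄ (30700) from the core 28544. [folklore] -/
theorem pureDimFour_of_core (h : MaxContactCut.StepPICoreDimFour) : MaxContactCut.StepPICorePureDimFour := by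
  intro p hp k _ _ n hn ih Y g hgs hgf hgq hY hdim Γ b hbs hbf hbq hbir hred hdat
  obtain ⟨I, hbl, hord, hex, _, hloc⟩ := hdat
  exact h p hp k n hn ih Y g hgs hgf hgq hY hdim Γ b hbs hbf hbq hbir hred ⟨I, hbl, hord, hex, hloc⟩

/-- IMPURE₄ → PURE₄ → `MaxContactCut.StepPICoreDimFour` (28544 BY NAME): excluded middle on the purity clause.
[folklore] -/
theorem coreDimFour_of_impure_of_pure (hI : MaxContactCut.StepPICoreImpureDimFour)
    (hQ : MaxContactCut.StepPICorePureDimFour) : MaxContactCut.StepPICoreDimFour := by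
  intro p hp k _ _ n hn ih Y g hgs hgf hgq hY hdim Γ b hbs hbf hbq hbir hred hdat
  obtain ⟨I, hbl, hord, ⟨y, hyn, hcf, hhyp⟩, hloc⟩ := hdat
  refine (Classical.em _).elim
    (fun hall => hQ p hp k n hn ih Y g hgs hgf hgq hY hdim Γ b hbs hbf hbq hbir hred
      ⟨I, hbl, hord, ⟨y, hyn, hcf, hhyp⟩, hall, hloc⟩)
    (fun hnall => ?_)
  obtain ⟨y', hy'⟩ := not_forall.mp hnall
  obtain ⟨h1, hy'⟩ := Classical.not_imp.mp hy'
  obtain ⟨h2, hy'⟩ := Classical.not_imp.mp hy'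
  obtain ⟨h3, h4⟩ := Classical.not_imp.mp hy'
  exact hI p hp k n hn ih Y g hgs hgf hgq hY hdim Γ b hbs hbf hbq hbir hred
    ⟨I, hbl, hord, ⟨y', h1, h2, h3, Classical.not_not.mp h4⟩, hloc⟩

/-- **EXACTNESS**: `StepPICoreDimFour (28544) ⟺ IMPURE₄ ∧ PURE₄`. [folklore] -/
theorem coreDimFour_iff_impure_and_pure :
    MaxContactCut.StepPICoreDimFour ↔
      MaxContactCut.StepPICoreImpureDimFour ∧ MaxContactCut.StepPICorePureDimFour :=
  ⟨fun h => ⟨impureDimFour_of_core h, pureDimFour_of_core h⟩, fun h => coreDimFour_of_impure_of_pure h.1 h.2⟩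

/-- PURE₄ → PURE-TAME₄ (30701). [folklore] -/
theorem pureTameDimFour_of_pure (h : MaxContactCut.StepPICorePureDimFour) :
    MaxContactCut.StepPICorePureTameDimFour :=
  fun p hp k _ _ n hn _ => h p hp k n hn

/-- PURE₄ → PURE-LOW₄ (30702). [folklore] -/
theorem pureLowDimFour_of_pure (h : MaxContactCut.StepPICorePureDimFour) :
    MaxContactCut.StepPICorePureLowDimFour :=
  fun p hp k _ _ n hn _ _ => h p hp k n hn

/-- PURE₄ → PURE-HIGH₄ (30703). [folklore] -/
theorem pureHighDimFour_of_pure (h : MaxContactCut.StepPICorePureDimFour) :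
    MaxContactCut.StepPICorePureHighDimFour :=
  fun p hp k _ _ n hn _ _ => h p hp k n hn

/-- The trisection of PURE₄ by the parameters: `n < p`, `p ≤ n ≤ 3`, `p ≤ n ∧ 4 ≤ n`. [folklore] -/
theorem pureDimFour_of_three (hT : MaxContactCut.StepPICorePureTameDimFour)
    (hL : MaxContactCut.StepPICorePureLowDimFour) (hH : MaxContactCut.StepPICorePureHighDimFour) :
    MaxContactCut.StepPICorePureDimFour := by
  intro p hp k _ _ n hn
  by_cases h1 : n < p
  · exact hT p hp k n hn h1
  · by_cases h2 : n ≤ 3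
    · exact hL p hp k n hn (by omega) h2
    · exact hH p hp k n hn (by omega) (by omega)

/-- `PURE₄ ⟺ PURE-TAME₄ ∧ PURE-LOW₄ ∧ PURE-HIGH₄`. [folklore] -/
theorem pureDimFour_iff_three :
    MaxContactCut.StepPICorePureDimFour ↔
      MaxContactCut.StepPICorePureTameDimFour ∧ MaxContactCut.StepPICorePureLowDimFour ∧
        MaxContactCut.StepPICorePureHighDimFour :=
  ⟨fun h => ⟨pureTameDimFour_of_pure h, pureLowDimFour_of_pure h, pureHighDimFour_of_pure h⟩,
    fun h => pureDimFour_of_three h.1 h.2.1 h.2.2⟩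

/-- **EXACTNESS of the node**: `StepPICoreDimFour (28544) ⟺ IMPURE₄ ∧ PURE-TAME₄ ∧ PURE-LOW₄ ∧ PURE-HIGH₄`.
[folklore] -/
theorem coreDimFour_iff_pieces :
    MaxContactCut.StepPICoreDimFour ↔
      MaxContactCut.StepPICoreImpureDimFour ∧ MaxContactCut.StepPICorePureTameDimFour ∧
        MaxContactCut.StepPICorePureLowDimFour ∧ MaxContactCut.StepPICorePureHighDimFour := by
  rw [coreDimFour_iff_impure_and_pure, pureDimFour_iff_three]

/-! ## All dimensions (used by `closes`) -/

/-- Necessity of IMPURE (30704) from the all-dimension core 28538. [folklore] -/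
theorem impure_of_core (h : MaxContactCut.StepPICore) : MaxContactCut.StepPICoreImpure := by
  intro p hp k _ _ n hn ih Y g hgs hgf hgq hY Γ b hbs hbf hbq hbir hred hdat
  obtain ⟨I, hbl, hord, ⟨y, hyn, hcf, hhyp, _⟩, hloc⟩ := hdat
  exact h p hp k n hn ih Y g hgs hgf hgq hY Γ b hbs hbf hbq hbir hred ⟨I, hbl, hord, ⟨y, hyn, hcf, hhyp⟩, hloc⟩

/-- Necessity of PURE (30705) from the all-dimension core 28538. [folklore] -/
theorem pure_of_core (h : MaxContactCut.StepPICore) : MaxContactCut.StepPICorePure := by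
  intro p hp k _ _ n hn ih Y g hgs hgf hgq hY Γ b hbs hbf hbq hbir hred hdat
  obtain ⟨I, hbl, hord, hex, _, hloc⟩ := hdat
  exact h p hp k n hn ih Y g hgs hgf hgq hY Γ b hbs hbf hbq hbir hred ⟨I, hbl, hord, hex, hloc⟩

/-- IMPURE → PURE → `MaxContactCut.StepPICore` (28538 BY NAME). [folklore] -/
theorem core_of_impure_of_pure (hI : MaxContactCut.StepPICoreImpure) (hQ : MaxContactCut.StepPICorePure) :
    MaxContactCut.StepPICore := by
  intro p hp k _ _ n hn ih Y g hgs hgf hgq hY Γ b hbs hbf hbq hbir hred hdat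
  obtain ⟨I, hbl, hord, ⟨y, hyn, hcf, hhyp⟩, hloc⟩ := hdat
  refine (Classical.em _).elim
    (fun hall => hQ p hp k n hn ih Y g hgs hgf hgq hY Γ b hbs hbf hbq hbir hred
      ⟨I, hbl, hord, ⟨y, hyn, hcf, hhyp⟩, hall, hloc⟩)
    (fun hnall => ?_)
  obtain ⟨y', hy'⟩ := not_forall.mp hnall
  obtain ⟨h1, hy'⟩ := Classical.not_imp.mp hy'
  obtain ⟨h2, hy'⟩ := Classical.not_imp.mp hy'
  obtain ⟨h3, h4⟩ := Classical.not_imp.mp hy'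
  exact hI p hp k n hn ih Y g hgs hgf hgq hY Γ b hbs hbf hbq hbir hred
    ⟨I, hbl, hord, ⟨y', h1, h2, h3, Classical.not_not.mp h4⟩, hloc⟩

/-- **EXACTNESS (all dimensions)**: `StepPICore (28538) ⟺ IMPURE ∧ PURE`. [folklore] -/
theorem core_iff_impure_and_pure :
    MaxContactCut.StepPICore ↔ MaxContactCut.StepPICoreImpure ∧ MaxContactCut.StepPICorePure :=
  ⟨fun h => ⟨impure_of_core h, pure_of_core h⟩, fun h => core_of_impure_of_pure h.1 h.2⟩

/-! ## The decided leaf PURE-HIGH₄ and the node's exactness without it -/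

/-- **PURE-HIGH₄ HOLDS** (30703, decided leaf): for `p ≤ n` and `4 ≤ n` the located point of the datum is
Fedder-impure by the certificate (`dim Y ≤ 4 ⟹ 𝔪_y` has `≤ 4 ≤ n` generators), contradicting the purity clause.
[folklore] -/
theorem stepPICorePureHighDimFour_holds : MaxContactCut.StepPICorePureHighDimFour := by
  intro p hp k _ _ n hn hpn h4 ih Y g hgs hgf hgq hY hdim Γ b hbs hbf hbq hbir hred hdat
  obtain ⟨I, -, -, ⟨y, hyn, hcf, hhyp⟩, hall, -⟩ := hdat
  exact absurd (FrobeniusBracketPow.fedderImpure_of_hyperplanar_of_regular g hY (d := 4)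
    (by exact_mod_cast hdim) I hp.two_le hpn h4 hhyp) (hall y hyn hcf hhyp)

/-- Hence the node's exactness WITHOUT the decided piece: `28544 ⟺ IMPURE₄ ∧ PURE-TAME₄ ∧ PURE-LOW₄`. [folklore] -/
theorem coreDimFour_iff_pieces' :
    MaxContactCut.StepPICoreDimFour ↔
      MaxContactCut.StepPICoreImpureDimFour ∧ MaxContactCut.StepPICorePureTameDimFour ∧
        MaxContactCut.StepPICorePureLowDimFour := by
  rw [coreDimFour_iff_pieces]
  exact ⟨fun h => ⟨h.1, h.2.1, h.2.2.1⟩, fun h => ⟨h.1, h.2.1, h.2.2, stepPICorePureHighDimFour_holds⟩⟩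

/-- IMPURE₄ → PURE-TAME₄ → PURE-LOW₄ → `MaxContactCut.StepPICoreDimFour` (28544 BY NAME). [folklore] -/
theorem coreDimFour_of_pieces (hI : MaxContactCut.StepPICoreImpureDimFour)
    (hT : MaxContactCut.StepPICorePureTameDimFour) (hL : MaxContactCut.StepPICorePureLowDimFour) :
    MaxContactCut.StepPICoreDimFour :=
  coreDimFour_iff_pieces'.mpr ⟨hI, hT, hL⟩

/-! ## Cross-lens square with ExponentLadder (29781 / 29782 BY NAME); perfect-column vacuity of PURE-TAME₄ -/

/-- **DEEP₄ ⊆ IMPURE₄**: lens-5's residual piece `StepPICoreDeepDimFour` (29782, `p² ∣ n`) follows from IMPURE₄ — a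
deep located point has `n ≥ p² ≥ max(p, 4)`, hence is Fedder-impure by the certificate. [folklore] -/
theorem deep_of_impure (hI : MaxContactCut.StepPICoreImpureDimFour) : MaxContactCut.StepPICoreDeepDimFour := by
  intro p hp k _ _ n hn hdeep ih Y g hgs hgf hgq hY hdim Γ b hbs hbf hbq hbir hred hdat
  obtain ⟨I, hbl, hord, ⟨y, hyn, hcf, hhyp⟩, hloc⟩ := hdat
  have hp2 : 2 ≤ p := hp.two_le
  have hsq : p ^ 2 ≤ n := Nat.le_of_dvd (by omega) hdeep
  have hpp : p ≤ p ^ 2 := Nat.le_self_pow two_ne_zero p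
  have h44 : 2 ^ 2 ≤ p ^ 2 := Nat.pow_le_pow_left hp2 2
  have hpn : p ≤ n := hpp.trans hsq
  have h4 : 4 ≤ n := by norm_num at h44; omega
  exact hI p hp k n hn ih Y g hgs hgf hgq hY hdim Γ b hbs hbf hbq hbir hred
    ⟨I, hbl, hord, ⟨y, hyn, hcf, hhyp, FrobeniusBracketPow.fedderImpure_of_hyperplanar_of_regular g hY (d := 4)
      (by exact_mod_cast hdim) I hp2 hpn h4 hhyp⟩, hloc⟩

/-- **PURE-TAME₄ ⊆ SHALLOW₄**: `n < p` (and `2 ≤ n`) excludes `p² ∣ n`, so lens-5's `StepPICoreShallowDimFour` (29781)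
gives it. [folklore] -/
theorem pureTameDimFour_of_shallow (hS : MaxContactCut.StepPICoreShallowDimFour) :
    MaxContactCut.StepPICorePureTameDimFour := by
  intro p hp k _ _ n hn hnp ih Y g hgs hgf hgq hY hdim Γ b hbs hbf hbq hbir hred hdat
  obtain ⟨I, hbl, hord, hex, _, hloc⟩ := hdat
  have hnd : ¬ p ^ 2 ∣ n := by
    intro hd
    have h1 : p ^ 2 ≤ n := Nat.le_of_dvd (by omega) hd
    have h2 : p ≤ p ^ 2 := Nat.le_self_pow two_ne_zero p
    omega
  exact hS p hp k n hn hnd ih Y g hgs hgf hgq hY hdim Γ b hbs hbf hbq hbir hred ⟨I, hbl, hord, hex, hloc⟩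

/-- **PURE-LOW₄ ⊆ SHALLOW₄**: `p ≤ n ≤ 3` excludes `p² ∣ n` (`p² ≥ 4`). [folklore] -/
theorem pureLowDimFour_of_shallow (hS : MaxContactCut.StepPICoreShallowDimFour) :
    MaxContactCut.StepPICorePureLowDimFour := by
  intro p hp k _ _ n hn hpn h3 ih Y g hgs hgf hgq hY hdim Γ b hbs hbf hbq hbir hred hdat
  obtain ⟨I, hbl, hord, hex, _, hloc⟩ := hdat
  have hnd : ¬ p ^ 2 ∣ n := by
    intro hd
    have h1 : p ^ 2 ≤ n := Nat.le_of_dvd (by omega) hd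
    have h2 : 2 ^ 2 ≤ p ^ 2 := Nat.pow_le_pow_left hp.two_le 2
    norm_num at h2
    omega
  exact hS p hp k n hn hnd ih Y g hgs hgf hgq hY hdim Γ b hbs hbf hbq hbir hred ⟨I, hbl, hord, hex, hloc⟩

/-- The lens-5 × lens-6 square at the rung: `SHALLOW₄ ∧ IMPURE₄ ⟹ 28544` (IMPURE₄ carries everything DEEP₄ carries,
and the two undecided pure pieces are bounded by SHALLOW₄). [folklore] -/
theorem coreDimFour_of_shallow_of_impure (hS : MaxContactCut.StepPICoreShallowDimFour)
    (hI : MaxContactCut.StepPICoreImpureDimFour) : MaxContactCut.StepPICoreDimFour :=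
  coreDimFour_of_pieces hI (pureTameDimFour_of_shallow hS) (pureLowDimFour_of_shallow hS)

/-- **Perfect column of PURE-TAME₄ is vacuous modulo the port item `TameHasContact` (28012)**: over a perfect field
there is NO contact-free point of order `n` with `1 ≤ n < p` (the typed contact clause of 28544 is exactly 28012's
conclusion). [folklore] -/
theorem no_contactFree_point_of_tameHasContact (hT : MaxContactCut.TameHasContact) {p : ℕ} (hp : p.Prime)
    {k : Type} [Field k] [CharP k p] [PerfectField k] {Y : Scheme.{0}} (g : Y ⟶ Spec (.of k))
    (hgs : IsSeparated g) (hgf : LocallyOfFiniteType g) (hgq : QuasiCompact g)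
    (hY : Literature.AlgebraicGeometry.Resolution.Scheme.IsRegular Y) (I : Y.IdealSheafData) {n : ℕ}
    (hn : 1 ≤ n) (hnp : n < p) {y : Y}
    (hyn : Literature.AlgebraicGeometry.Resolution.idealOrder I y = ((n : ℕ) : ℕ∞))
    (hcf : ¬ (∃ U : Y.affineOpens, ∃ hy : y ∈ (U : Y.Opens),
      ∃ u ∈ (Literature.AlgebraicGeometry.Resolution.diffIdealSheaf
        (g.appTop.hom.comp (AlgebraicGeometry.Scheme.ΓSpecIso (.of k)).inv.hom) (n - 1) I).ideal U,
        (Y.presheaf.germ U y hy).hom u ∈ IsLocalRing.maximalIdeal (Y.presheaf.stalk y) ∧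
        (Y.presheaf.germ U y hy).hom u ∉ IsLocalRing.maximalIdeal (Y.presheaf.stalk y) ^ 2)) : False :=
  hcf (hT p hp k Y g hgs hgf hgq hY I n hn hnp y hyn)

/-! ## Deciding theorem (ROOT BY NAME) and necessity of every piece -/

/-- **closes**: RegularRoofs (24573) → PencilReduction (27129) → OrderBound (28006) → LocalOrderOneResolve (27132)
→ StepContact (28005) → StepCFHigher (28537) → IMPURE (30704) → PURE (30705) → the ROOT, through
`MaxContactCutTauCut.closes_tauCut`. [folklore] -/
theorem closes (hR : MaxContactCut.RegularRoofs) (hP : MaxContactCut.PencilReduction) (hB : MaxContactCut.OrderBound)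
    (h1 : MaxContactCut.LocalOrderOneResolve) (hC : MaxContactCut.StepContact) (hH : MaxContactCut.StepCFHigher)
    (hI : MaxContactCut.StepPICoreImpure) (hQ : MaxContactCut.StepPICorePure) : _root_.ResolutionOfSingularities :=
  MaxContactCutTauCut.closes_tauCut hR hP hB h1 hC hH (core_of_impure_of_pure hI hQ)

/-- IMPURE₄ is summit-implied. [folklore] -/
theorem impureDimFour_of_summit (h : _root_.ResolutionOfSingularities) : MaxContactCut.StepPICoreImpureDimFour :=
  impureDimFour_of_core (MaxContactCutTauCut.stepPICoreDimFour_of_summit h)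

/-- PURE₄ is summit-implied. [folklore] -/
theorem pureDimFour_of_summit (h : _root_.ResolutionOfSingularities) : MaxContactCut.StepPICorePureDimFour :=
  pureDimFour_of_core (MaxContactCutTauCut.stepPICoreDimFour_of_summit h)

/-- PURE-TAME₄ is summit-implied. [folklore] -/
theorem pureTameDimFour_of_summit (h : _root_.ResolutionOfSingularities) :
    MaxContactCut.StepPICorePureTameDimFour :=
  pureTameDimFour_of_pure (pureDimFour_of_summit h)

/-- PURE-LOW₄ is summit-implied. [folklore] -/
theorem pureLowDimFour_of_summit (h : _root_.ResolutionOfSingularities) :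
    MaxContactCut.StepPICorePureLowDimFour :=
  pureLowDimFour_of_pure (pureDimFour_of_summit h)

/-- IMPURE is summit-implied. [folklore] -/
theorem impure_of_summit (h : _root_.ResolutionOfSingularities) : MaxContactCut.StepPICoreImpure :=
  impure_of_core (MaxContactCutTauCut.stepPICore_of_summit h)

/-- PURE is summit-implied. [folklore] -/
theorem pure_of_summit (h : _root_.ResolutionOfSingularities) : MaxContactCut.StepPICorePure :=
  pure_of_core (MaxContactCutTauCut.stepPICore_of_summit h)

/-- Every piece of the node is summit-implied (none is stronger than the summit); PURE-HIGH₄ holds outright.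
[folklore] -/
theorem pieces_of_summit (h : _root_.ResolutionOfSingularities) :
    MaxContactCut.StepPICoreImpure ∧ MaxContactCut.StepPICorePure ∧ MaxContactCut.StepPICoreImpureDimFour ∧
      MaxContactCut.StepPICorePureDimFour ∧ MaxContactCut.StepPICorePureTameDimFour ∧
        MaxContactCut.StepPICorePureLowDimFour ∧ MaxContactCut.StepPICorePureHighDimFour :=
  ⟨impure_of_summit h, pure_of_summit h, impureDimFour_of_summit h, pureDimFour_of_summit h,
    pureTameDimFour_of_summit h, pureLowDimFour_of_summit h, stepPICorePureHighDimFour_holds⟩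

end Summit.ResolutionOfSingularities.ResolutionOfSingularities.Theorems.MaxContactCutFedderCut
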